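import Summits.Ventures.AbcSig.Rows.StatementsC1b
import Summits.Ventures.AbcSig.Rows.Xn4Yn7Z2X

/-!
# Venture AbcSig — CELL bridge for `xⁿ + 2^α yⁿ = 7 z²` (FAMILY C1b, `α = 2`): p1's census predicate `Rows.C1bCell 7 (fun _ α => α = 2) 11 ∅`

HONEST FRAMING. COMPUTATION cell `pub-abcsig`; CONDITIONAL theorem; no claim on ABC or any summit. Hypotheses exactly
those of `Rows/Xn4Yn7Z2X.lean` (`xrow_Xn4Yn7Z2`): `BS04Package` (CITED), `DataComplete` at the two levels (COMPUTED, certified level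
files) and the row's per-orbit CITED exclusions `hX_…`, universally quantified in the exponent. Conclusion = the conjunct
`Rows.C1bCell 7 (fun _ α => α = 2) 11 ∅` of p1's `Rows.C1bSmallAlphaSigned` / `Rows.C1bExtSigned`
(`Rows/StatementsC1b.lean`; row of record `census/rows/C1b/C1b-C7-a2.md`, R8-signed): every prime `n ≥ 11`, `n ∤ 7`,
`α = 2`, no primitive solution with `|xy| > 1`. GENERATED by p-lean gen3/make_c1bcell.py (pattern of `Rows/Xn8Yn11Z2Cell.lean`).
-/

namespace Summit.Ventures.AbcSig

/-- `xⁿ + 2^α yⁿ = 7z²` (`α = 2`), every prime `n ≥ 11` with `n ∤ 7`, `|xy| > 1`: p1's conjunct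
`Rows.C1bCell 7 (fun _ α => α = 2) 11 ∅` from `xrow_Xn4Yn7Z2`. -/
theorem C1bCell_7_a2_of (M : NewformModel) (hP : M.BS04Package)
    (hD196 : M.DataComplete 196 level196Orbits)
    (hD392 : M.DataComplete 392 level392Orbits)
    (hD98 : M.DataComplete 98 level98Orbits)
    (hX_orbit_392_3 : ∀ n : ℕ, M.Excludes 392 orbit_392_3 (famBC 2 7 n (fun _ b => (4 : ℤ) ∣ b - 7)))
    (hX_orbit_392_5 : ∀ n : ℕ, M.Excludes 392 orbit_392_5 (famBC 2 7 n (fun _ b => (4 : ℤ) ∣ b - 7)))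
    (hX_orbit_98_1 : ∀ n : ℕ, M.Excludes 98 orbit_98_1 (famBC 2 7 n (fun _ b => 2 ∣ b))) :
    Rows.C1bCell 7 (fun _ α => α = 2) 11 ∅ := by
  intro n hn h0 _ _ α hα x y z h1 h2
  subst hα
  exact xrow_Xn4Yn7Z2 M hP hD196 hD392 hD98 n hn h0 (hX_orbit_392_3 n) (hX_orbit_392_5 n) (hX_orbit_98_1 n) x y z h1 h2

end Summit.Ventures.AbcSig
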